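import Literature.Probability.LatticeModels.SRWHeatKernel1D
import HarnessLib

/-!
# Differences of the heat kernel of the continuous-time simple random walk on `ℤ`

Topic `Probability/LatticeModels`, continuation of `SRWHeatKernel1D.lean` (objects
`srwHeatKernel t m = q_t(m) = (1/2π) ∫_{-π}^{π} cos(km) e^{-t(1 - cos k)} dk`, the entire integrand
`srwHeatIntegrand t m z = e^{izm} e^{-t(1 - cos z)}` and its contour shift
`integral_srwHeatIntegrand_shift`). PROVED here, by the same contour shift `k ↦ k + iλ`
(the difference in `m` brings down the multiplier `e^{iz} - 1`, of modulus `≤ |k| + 2|λ|` on the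
shifted contour, and each power of `|k|` integrates against the heat weight to an extra factor
`(1 ∨ t)^{-1/2}`):

* `srwHeatKernel_fwdDiff_decay` : for every `p : ℕ` a constant `A` with
  `|q_t(m+1) - q_t(m)| ≤ A (1 ∨ t)^{-1} (1 + m²/(1 ∨ t))^{-p}` for all `t > 0`, `m ∈ ℤ`;
* `srwHeatKernel_bwdDiff_decay` : the same for `q_t(m) - q_t(m-1)`;
* `srwHeatKernel_sndDiff_decay` : `|q_t(m+1) - 2 q_t(m) + q_t(m-1)| ≤ A (1 ∨ t)^{-3/2} (1 + m²/(1 ∨ t))^{-p}`.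

These Gaussian-weighted gradient bounds (one, resp. two, orders `(1 ∨ t)^{-1/2}` beyond the size
`(1 ∨ t)^{-1/2}` of the kernel, `srwHeatKernel_decay`) are the one-dimensional input of the decay of
the derivatives of lattice Green functions (Lawler–Limic 2010, §2.3 and Thm. 4.3.1, where difference
estimates for the heat kernel are derived from the LCLT; here they come directly from the Chernoff
contour shift).

## References

* G. F. Lawler, V. Limic, *Random Walk: A Modern Introduction*, CUP 2010, §2.3 [LawlerLimic2010].

## Mathlib

Used: `integral_gaussian`, `Real.abs_exp_sub_one_le`, `Real.norm_exp_I_mul_ofReal_sub_one_le`,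
Jordan's inequality (through `exp_neg_mul_one_sub_cos_le` of the companion file).
-/

noncomputable section

open MeasureTheory Set Filter intervalIntegral
open scoped Real Topology

namespace Literature.Probability.LatticeModels

/-! ### Moments of the heat weight `e^{-t(1 - cos k)}` on `[-π, π]` -/

/-- `x e^{-x} ≤ 2 e^{-x/2}` for every real `x` (since `x/2 < e^{x/2}`). [folklore] -/
theorem mul_exp_neg_le_two_mul_exp_neg_half (x : ℝ) :
    x * Real.exp (-x) ≤ 2 * Real.exp (-(x / 2)) := by
  have h1 : x / 2 + 1 ≤ Real.exp (x / 2) := Real.add_one_le_exp _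
  have h2 : Real.exp (-x) = Real.exp (-(x / 2)) * Real.exp (-(x / 2)) := by
    rw [← Real.exp_add]; ring_nf
  have h3 : Real.exp (x / 2) * Real.exp (-(x / 2)) = 1 := by
    rw [← Real.exp_add]; simp
  have h4 : x ≤ 2 * Real.exp (x / 2) := by linarith
  calc x * Real.exp (-x) = x * (Real.exp (-(x / 2)) * Real.exp (-(x / 2))) := by rw [h2]
    _ ≤ 2 * Real.exp (x / 2) * (Real.exp (-(x / 2)) * Real.exp (-(x / 2))) := by
        gcongr
    _ = 2 * (Real.exp (x / 2) * Real.exp (-(x / 2))) * Real.exp (-(x / 2)) := by ring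
    _ = 2 * Real.exp (-(x / 2)) := by rw [h3, mul_one]

/-- `(1 ∨ t)^{-1/2} · (1 ∨ t)^{-1/2} = (1 ∨ t)^{-1}`. [folklore] -/
theorem max_one_rpow_neg_half_mul_self (t : ℝ) :
    (max 1 t) ^ (-(1 / 2 : ℝ)) * (max 1 t) ^ (-(1 / 2 : ℝ)) = (max 1 t)⁻¹ := by
  have hT : (0 : ℝ) < max 1 t := by positivity
  rw [← Real.rpow_add hT, ← Real.rpow_neg_one]
  norm_num

/-- **Second moment of the heat weight**:
`∫_{-π}^{π} k² e^{-t(1 - cos k)} dk ≤ 128 (1 ∨ t)^{-1} (1 ∨ t)^{-1/2}` for `t ≥ 0` (trivially `≤ 2π³`;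
for `t ≥ 1` through Jordan's inequality `e^{-t(1-cos k)} ≤ e^{-bk²}`, `b = 2t/π²`, the bound
`bk² e^{-bk²} ≤ 2 e^{-bk²/2}` and the Gaussian integral). [folklore] -/
theorem integral_sq_mul_exp_neg_mul_one_sub_cos_le {t : ℝ} (ht : 0 ≤ t) :
    ∫ k in (-π)..π, k ^ 2 * Real.exp (-(t * (1 - Real.cos k))) ≤
      128 * ((max 1 t)⁻¹ * (max 1 t) ^ (-(1 / 2 : ℝ))) := by
  have hle : (-π : ℝ) ≤ π := by linarith [Real.pi_pos]
  have hcont : Continuous fun k : ℝ => k ^ 2 * Real.exp (-(t * (1 - Real.cos k))) := by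
    fun_prop
  have hπ := Real.pi_pos
  have hπ4 := Real.pi_le_four
  -- the trivial bound
  have htriv : ∫ k in (-π)..π, k ^ 2 * Real.exp (-(t * (1 - Real.cos k))) ≤ 2 * π ^ 3 := by
    calc ∫ k in (-π)..π, k ^ 2 * Real.exp (-(t * (1 - Real.cos k)))
        ≤ ∫ _ in (-π)..π, π ^ 2 := by
          refine intervalIntegral.integral_mono_on hle (hcont.intervalIntegrable _ _) (by simp)
            fun k hk => ?_
          have h1 : k ^ 2 ≤ π ^ 2 := by
            rw [sq_le_sq, abs_of_pos hπ]
            exact abs_le.2 ⟨hk.1, hk.2⟩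
          have h2 : Real.exp (-(t * (1 - Real.cos k))) ≤ 1 := by
            rw [Real.exp_le_one_iff, neg_nonpos]
            exact mul_nonneg ht (sub_nonneg.2 (Real.cos_le_one k))
          calc k ^ 2 * Real.exp (-(t * (1 - Real.cos k))) ≤ π ^ 2 * 1 :=
              mul_le_mul h1 h2 (Real.exp_pos _).le (by positivity)
            _ = π ^ 2 := mul_one _
      _ = 2 * π ^ 3 := by simp; ring
  rcases le_or_gt t 1 with h1 | h1
  · rw [max_eq_left h1, Real.one_rpow, inv_one, mul_one, mul_one]
    calc _ ≤ 2 * π ^ 3 := htriv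
      _ ≤ 2 * 4 ^ 3 := by gcongr
      _ = 128 := by norm_num
  · rw [max_eq_right h1.le]
    have ht0 : 0 < t := by linarith
    set b : ℝ := 2 * t / π ^ 2 with hb
    have hb0 : 0 < b := by positivity
    have hgi := integrable_exp_neg_mul_sq (half_pos hb0)
    calc ∫ k in (-π)..π, k ^ 2 * Real.exp (-(t * (1 - Real.cos k)))
        ≤ ∫ k in (-π)..π, 2 / b * Real.exp (-(b / 2) * k ^ 2) := by
          refine intervalIntegral.integral_mono_on hle (hcont.intervalIntegrable _ _)
            ((hgi.const_mul _).intervalIntegrable) fun k hk => ?_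
          have hJ := exp_neg_mul_one_sub_cos_le ht (abs_le.2 ⟨by linarith [hk.1], hk.2⟩)
          have hx := mul_exp_neg_le_two_mul_exp_neg_half (b * k ^ 2)
          calc k ^ 2 * Real.exp (-(t * (1 - Real.cos k)))
              ≤ k ^ 2 * Real.exp (-(2 * t / π ^ 2) * k ^ 2) := by gcongr
            _ = b⁻¹ * ((b * k ^ 2) * Real.exp (-(b * k ^ 2))) := by
                rw [← hb, neg_mul]
                field_simp
            _ ≤ b⁻¹ * (2 * Real.exp (-(b * k ^ 2 / 2))) := by gcongr
            _ = 2 / b * Real.exp (-(b / 2) * k ^ 2) := by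
                rw [show -(b * k ^ 2 / 2) = -(b / 2) * k ^ 2 by ring]
                ring
      _ ≤ ∫ k, 2 / b * Real.exp (-(b / 2) * k ^ 2) := by
          rw [intervalIntegral.integral_of_le hle]
          exact setIntegral_le_integral (hgi.const_mul _)
            (Eventually.of_forall fun k => by positivity)
      _ = 2 / b * Real.sqrt (π / (b / 2)) := by
          rw [MeasureTheory.integral_const_mul, integral_gaussian]
      _ = (π ^ 2 * Real.sqrt (π ^ 3)) * (t⁻¹ * t ^ (-(1 / 2 : ℝ))) := by
          have e1 : 2 / b = π ^ 2 * t⁻¹ := by rw [hb]; field_simp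
          have e2 : π / (b / 2) = π ^ 3 * t⁻¹ := by rw [hb]; field_simp
          rw [e1, e2, Real.sqrt_mul (by positivity), Real.sqrt_inv, Real.rpow_neg ht0.le,
            Real.sqrt_eq_rpow t]
          ring
      _ ≤ 128 * (t⁻¹ * t ^ (-(1 / 2 : ℝ))) := by
          refine mul_le_mul_of_nonneg_right ?_ (by positivity)
          have h3 : Real.sqrt (π ^ 3) ≤ 8 := by
            rw [show (8 : ℝ) = Real.sqrt (8 ^ 2) by rw [Real.sqrt_sq (by norm_num)]]
            exact Real.sqrt_le_sqrt (by nlinarith)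
          calc π ^ 2 * Real.sqrt (π ^ 3) ≤ 4 ^ 2 * 8 := by gcongr
            _ = 128 := by norm_num

/-- **First absolute moment of the heat weight**:
`∫_{-π}^{π} |k| e^{-t(1 - cos k)} dk ≤ 68 (1 ∨ t)^{-1}` for `t ≥ 0` (from the zeroth and second
moments through `|k| ≤ k²/(2s) + s/2`, `s = (1 ∨ t)^{-1/2}`). [folklore] -/
theorem integral_abs_mul_exp_neg_mul_one_sub_cos_le {t : ℝ} (ht : 0 ≤ t) :
    ∫ k in (-π)..π, |k| * Real.exp (-(t * (1 - Real.cos k))) ≤ 68 * (max 1 t)⁻¹ := by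
  have hle : (-π : ℝ) ≤ π := by linarith [Real.pi_pos]
  have hπ4 := Real.pi_le_four
  have I0 := integral_exp_neg_mul_one_sub_cos_le ht
  have I2 := integral_sq_mul_exp_neg_mul_one_sub_cos_le ht
  have hss := max_one_rpow_neg_half_mul_self t
  set T : ℝ := max 1 t with hT
  set s : ℝ := T ^ (-(1 / 2 : ℝ)) with hs
  have hT0 : 0 < T := by positivity
  have hs0 : 0 < s := Real.rpow_pos_of_pos hT0 _
  have hamgm : ∀ k : ℝ, |k| ≤ (2 * s)⁻¹ * k ^ 2 + s / 2 := fun k => by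
    have h0 : 0 ≤ (|k| - s) ^ 2 := sq_nonneg _
    have hk2 : |k| ^ 2 = k ^ 2 := sq_abs k
    have : |k| * (2 * s) ≤ k ^ 2 + s * s := by nlinarith
    calc |k| = |k| * (2 * s) * (2 * s)⁻¹ := by field_simp
      _ ≤ (k ^ 2 + s * s) * (2 * s)⁻¹ := by gcongr
      _ = (2 * s)⁻¹ * k ^ 2 + s / 2 := by field_simp
  have hc0 : Continuous fun k : ℝ => Real.exp (-(t * (1 - Real.cos k))) := by fun_prop
  have hc1 : Continuous fun k : ℝ => |k| * Real.exp (-(t * (1 - Real.cos k))) := by fun_prop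
  have hc2 : Continuous fun k : ℝ => k ^ 2 * Real.exp (-(t * (1 - Real.cos k))) := by fun_prop
  calc ∫ k in (-π)..π, |k| * Real.exp (-(t * (1 - Real.cos k)))
      ≤ ∫ k in (-π)..π, ((2 * s)⁻¹ * (k ^ 2 * Real.exp (-(t * (1 - Real.cos k)))) +
          (s / 2) * Real.exp (-(t * (1 - Real.cos k)))) := by
        refine intervalIntegral.integral_mono_on hle (hc1.intervalIntegrable _ _)
          (Continuous.intervalIntegrable (by fun_prop) _ _) fun k _ => ?_
        have hw : 0 ≤ Real.exp (-(t * (1 - Real.cos k))) := (Real.exp_pos _).le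
        calc |k| * Real.exp (-(t * (1 - Real.cos k)))
            ≤ ((2 * s)⁻¹ * k ^ 2 + s / 2) * Real.exp (-(t * (1 - Real.cos k))) :=
              mul_le_mul_of_nonneg_right (hamgm k) hw
          _ = _ := by ring
    _ = (2 * s)⁻¹ * (∫ k in (-π)..π, k ^ 2 * Real.exp (-(t * (1 - Real.cos k)))) +
          (s / 2) * ∫ k in (-π)..π, Real.exp (-(t * (1 - Real.cos k))) := by
        rw [intervalIntegral.integral_add ((hc2.const_mul _).intervalIntegrable _ _)
          ((hc0.const_mul _).intervalIntegrable _ _), intervalIntegral.integral_const_mul,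
          intervalIntegral.integral_const_mul]
    _ ≤ (2 * s)⁻¹ * (128 * (T⁻¹ * s)) + (s / 2) * (2 * π * s) := by gcongr
    _ = (64 + π) * T⁻¹ := by rw [← hss]; field_simp; ring
    _ ≤ 68 * T⁻¹ := by gcongr; linarith

/-! ### The multipliers `e^{±iz} - 1` on the shifted contour -/

/-- `‖e^{w} - 1‖ ≤ |Im w| + 2 |Re w|` for `|Re w| ≤ 1`. [folklore] -/
theorem norm_cexp_sub_one_le_im_add_re {w : ℂ} (hw : |w.re| ≤ 1) :
    ‖Complex.exp w - 1‖ ≤ |w.im| + 2 * |w.re| := by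
  have hsplit : Complex.exp w - 1 =
      Complex.exp (Complex.I * w.im) * (Complex.exp (w.re : ℂ) - 1) +
        (Complex.exp (Complex.I * w.im) - 1) := by
    have : w = (w.re : ℂ) + Complex.I * w.im := by
      rw [mul_comm]; exact (Complex.re_add_im w).symm
    conv_lhs => rw [this, Complex.exp_add]
    ring
  rw [hsplit]
  refine (norm_add_le _ _).trans ?_
  rw [norm_mul, Complex.norm_exp_I_mul_ofReal, one_mul, ← Complex.ofReal_exp, ← Complex.ofReal_one,
    ← Complex.ofReal_sub, Complex.norm_real, Real.norm_eq_abs, add_comm]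
  gcongr
  · exact (Real.norm_exp_I_mul_ofReal_sub_one_le).trans (le_of_eq (Real.norm_eq_abs _))
  · exact Real.abs_exp_sub_one_le hw

/-- On the shifted contour, `‖e^{i(k + iλ)} - 1‖ ≤ |k| + 2|λ|` for `|λ| ≤ 1`. [folklore] -/
theorem norm_cexp_I_mul_shift_sub_one_le (k : ℝ) {lam : ℝ} (hl : |lam| ≤ 1) :
    ‖Complex.exp (Complex.I * ((k : ℂ) + lam * Complex.I)) - 1‖ ≤ |k| + 2 * |lam| := by
  have hre : (Complex.I * ((k : ℂ) + lam * Complex.I)).re = -lam := by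
    simp [Complex.mul_re]
  have him : (Complex.I * ((k : ℂ) + lam * Complex.I)).im = k := by
    simp [Complex.mul_im]
  have h := norm_cexp_sub_one_le_im_add_re (w := Complex.I * ((k : ℂ) + lam * Complex.I))
    (by rw [hre, abs_neg]; exact hl)
  rwa [hre, him, abs_neg] at h

/-- On the shifted contour, `‖e^{-i(k + iλ)} - 1‖ ≤ |k| + 2|λ|` for `|λ| ≤ 1`. [folklore] -/
theorem norm_cexp_neg_I_mul_shift_sub_one_le (k : ℝ) {lam : ℝ} (hl : |lam| ≤ 1) :
    ‖Complex.exp (-(Complex.I * ((k : ℂ) + lam * Complex.I))) - 1‖ ≤ |k| + 2 * |lam| := by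
  have hre : (-(Complex.I * ((k : ℂ) + lam * Complex.I))).re = lam := by
    simp [Complex.mul_re]
  have him : (-(Complex.I * ((k : ℂ) + lam * Complex.I))).im = -k := by
    simp [Complex.mul_im]
  have h := norm_cexp_sub_one_le_im_add_re (w := -(Complex.I * ((k : ℂ) + lam * Complex.I)))
    (by rw [hre]; exact hl)
  rwa [hre, him, abs_neg] at h

/-- `(|k| + 2|λ|)² ≤ 2k² + 8λ²`. [folklore] -/
theorem abs_add_two_mul_abs_sq_le (k lam : ℝ) : (|k| + 2 * |lam|) ^ 2 ≤ 2 * k ^ 2 + 8 * lam ^ 2 := by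
  have h1 : |k| ^ 2 = k ^ 2 := sq_abs k
  have h2 : |lam| ^ 2 = lam ^ 2 := sq_abs lam
  nlinarith [sq_nonneg (|k| - 2 * |lam|)]

/-! ### The differences as shifted contour integrals -/

/-- `F_{t,m+1}(z) = e^{iz} F_{t,m}(z)`. [folklore] -/
theorem srwHeatIntegrand_add_one (t : ℝ) (m : ℤ) (z : ℂ) :
    srwHeatIntegrand t (m + 1) z = Complex.exp (Complex.I * z) * srwHeatIntegrand t m z := by
  unfold srwHeatIntegrand
  rw [← mul_assoc, ← Complex.exp_add (Complex.I * z)]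
  congr 2
  push_cast
  ring

/-- `F_{t,m-1}(z) = e^{-iz} F_{t,m}(z)`. [folklore] -/
theorem srwHeatIntegrand_sub_one (t : ℝ) (m : ℤ) (z : ℂ) :
    srwHeatIntegrand t (m - 1) z = Complex.exp (-(Complex.I * z)) * srwHeatIntegrand t m z := by
  unfold srwHeatIntegrand
  rw [← mul_assoc, ← Complex.exp_add (-(Complex.I * z))]
  congr 2
  push_cast
  ring

/-- The shifted integrand is continuous in `k`. [folklore] -/
theorem continuous_srwHeatIntegrand_shift (t : ℝ) (m : ℤ) (lam : ℝ) :
    Continuous fun k : ℝ => srwHeatIntegrand t m ((k : ℂ) + lam * Complex.I) :=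
  (differentiable_srwHeatIntegrand t m).continuous.comp (by fun_prop)

/-- **The forward difference as a shifted contour integral**:
`2π (q_t(m+1) - q_t(m)) = ∫_{-π}^{π} (e^{i(k+iλ)} - 1) F_{t,m}(k + iλ) dk`. [folklore] -/
theorem fwdDiff_srwHeatKernel_eq_integral (t : ℝ) (m : ℤ) (lam : ℝ) :
    (((2 * π * (srwHeatKernel t (m + 1) - srwHeatKernel t m)) : ℝ) : ℂ) =
      ∫ k in (-π)..π, (Complex.exp (Complex.I * ((k : ℂ) + lam * Complex.I)) - 1) *
        srwHeatIntegrand t m ((k : ℂ) + lam * Complex.I) := by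
  have h1 := integral_srwHeatIntegrand_shift t (m + 1) lam
  have h2 := integral_srwHeatIntegrand_shift t m lam
  rw [integral_srwHeatIntegrand] at h1 h2
  have hc := continuous_srwHeatIntegrand_shift t
  simp_rw [sub_mul, one_mul, ← srwHeatIntegrand_add_one]
  have i1 : IntervalIntegrable (fun k : ℝ => srwHeatIntegrand t (m + 1) ((k : ℂ) + lam * Complex.I))
      volume (-π) π := (hc _ _).intervalIntegrable _ _
  have i2 : IntervalIntegrable (fun k : ℝ => srwHeatIntegrand t m ((k : ℂ) + lam * Complex.I))
      volume (-π) π := (hc _ _).intervalIntegrable _ _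
  rw [intervalIntegral.integral_sub i1 i2, ← h1, ← h2]
  push_cast
  ring

/-- **The second difference as a shifted contour integral**:
`2π (q_t(m+1) - 2q_t(m) + q_t(m-1)) = ∫_{-π}^{π} (e^{i(k+iλ)} - 2 + e^{-i(k+iλ)}) F_{t,m}(k + iλ) dk`.
[folklore] -/
theorem sndDiff_srwHeatKernel_eq_integral (t : ℝ) (m : ℤ) (lam : ℝ) :
    (((2 * π * (srwHeatKernel t (m + 1) - 2 * srwHeatKernel t m + srwHeatKernel t (m - 1))) : ℝ) : ℂ) =
      ∫ k in (-π)..π, (Complex.exp (Complex.I * ((k : ℂ) + lam * Complex.I)) - 2 +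
          Complex.exp (-(Complex.I * ((k : ℂ) + lam * Complex.I)))) *
        srwHeatIntegrand t m ((k : ℂ) + lam * Complex.I) := by
  have h1 := integral_srwHeatIntegrand_shift t (m + 1) lam
  have h2 := integral_srwHeatIntegrand_shift t m lam
  have h3 := integral_srwHeatIntegrand_shift t (m - 1) lam
  rw [integral_srwHeatIntegrand] at h1 h2 h3
  have hc := continuous_srwHeatIntegrand_shift t
  have hsplit : ∀ k : ℝ, (Complex.exp (Complex.I * ((k : ℂ) + lam * Complex.I)) - 2 +
      Complex.exp (-(Complex.I * ((k : ℂ) + lam * Complex.I)))) *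
        srwHeatIntegrand t m ((k : ℂ) + lam * Complex.I) =
      srwHeatIntegrand t (m + 1) ((k : ℂ) + lam * Complex.I) -
        2 * srwHeatIntegrand t m ((k : ℂ) + lam * Complex.I) +
        srwHeatIntegrand t (m - 1) ((k : ℂ) + lam * Complex.I) := fun k => by
    rw [srwHeatIntegrand_add_one, srwHeatIntegrand_sub_one]
    ring
  simp_rw [hsplit]
  have i1 : IntervalIntegrable (fun k : ℝ => srwHeatIntegrand t (m + 1) ((k : ℂ) + lam * Complex.I))
      volume (-π) π := (hc _ _).intervalIntegrable _ _
  have i2 : IntervalIntegrable (fun k : ℝ => 2 * srwHeatIntegrand t m ((k : ℂ) + lam * Complex.I))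
      volume (-π) π := ((hc _ _).const_mul _).intervalIntegrable _ _
  have i3 : IntervalIntegrable (fun k : ℝ => srwHeatIntegrand t (m - 1) ((k : ℂ) + lam * Complex.I))
      volume (-π) π := (hc _ _).intervalIntegrable _ _
  rw [intervalIntegral.integral_add (i1.sub i2) i3, intervalIntegral.integral_sub i1 i2,
    intervalIntegral.integral_const_mul, ← h1, ← h2, ← h3]
  push_cast
  ring

/-! ### Chernoff bounds for the differences -/

/-- The common estimate: if `‖M(k)‖ ≤ B(k)` on `[-π, π]`, then
`‖∫ M(k) F_{t,m}(k+iλ) dk‖ ≤ e^{-λm + t(cosh λ - 1)} ∫ B(k) e^{-t(1 - cos k)} dk`. [folklore] -/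
theorem norm_integral_mul_srwHeatIntegrand_shift_le {t : ℝ} (ht : 0 ≤ t) (m : ℤ) (lam : ℝ)
    {M : ℝ → ℂ} {B : ℝ → ℝ} (hM : Continuous M) (hB : Continuous B)
    (hMB : ∀ k ∈ Icc (-π) π, ‖M k‖ ≤ B k) :
    ‖∫ k in (-π)..π, M k * srwHeatIntegrand t m ((k : ℂ) + lam * Complex.I)‖ ≤
      Real.exp (-(lam * m) + t * (Real.cosh lam - 1)) *
        ∫ k in (-π)..π, B k * Real.exp (-(t * (1 - Real.cos k))) := by
  have hle : (-π : ℝ) ≤ π := by linarith [Real.pi_pos]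
  have hc := continuous_srwHeatIntegrand_shift t m lam
  calc ‖∫ k in (-π)..π, M k * srwHeatIntegrand t m ((k : ℂ) + lam * Complex.I)‖
      ≤ ∫ k in (-π)..π, ‖M k * srwHeatIntegrand t m ((k : ℂ) + lam * Complex.I)‖ :=
        intervalIntegral.norm_integral_le_integral_norm hle
    _ ≤ ∫ k in (-π)..π, B k * (Real.exp (-(lam * m) + t * (Real.cosh lam - 1)) *
          Real.exp (-(t * (1 - Real.cos k)))) := by
        refine intervalIntegral.integral_mono_on hle ((hM.mul hc).norm.intervalIntegrable _ _)
          (Continuous.intervalIntegrable (by fun_prop) _ _) fun k hk => ?_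
        rw [norm_mul, norm_srwHeatIntegrand_shift]
        have hB0 : 0 ≤ B k := (norm_nonneg _).trans (hMB k hk)
        calc ‖M k‖ * (Real.exp (-(lam * m)) * Real.exp (-(t * (1 - Real.cos k * Real.cosh lam))))
            ≤ B k * (Real.exp (-(lam * m)) * (Real.exp (t * (Real.cosh lam - 1)) *
                Real.exp (-(t * (1 - Real.cos k))))) := by
              gcongr
              · exact hMB k hk
              · exact exp_neg_mul_one_sub_cos_mul_cosh_le ht k lam
          _ = _ := by rw [Real.exp_add]; ring
    _ = Real.exp (-(lam * m) + t * (Real.cosh lam - 1)) *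
          ∫ k in (-π)..π, B k * Real.exp (-(t * (1 - Real.cos k))) := by
        rw [← intervalIntegral.integral_const_mul]
        congr 1
        funext k
        ring

/-- **Chernoff bound for the forward difference**: for `t ≥ 0`, `m ∈ ℤ`, `|λ| ≤ 1`,
`2π |q_t(m+1) - q_t(m)| ≤ e^{-λm + t(cosh λ - 1)} (68 (1∨t)^{-1} + 2|λ| · 2π (1∨t)^{-1/2})`. [folklore] -/
theorem abs_fwdDiff_srwHeatKernel_le_exp {t : ℝ} (ht : 0 ≤ t) (m : ℤ) {lam : ℝ} (hl : |lam| ≤ 1) :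
    2 * π * |srwHeatKernel t (m + 1) - srwHeatKernel t m| ≤
      Real.exp (-(lam * m) + t * (Real.cosh lam - 1)) *
        (68 * (max 1 t)⁻¹ + 2 * |lam| * (2 * π * (max 1 t) ^ (-(1 / 2 : ℝ)))) := by
  have hπ : 0 < 2 * π := by positivity
  have hnorm : 2 * π * |srwHeatKernel t (m + 1) - srwHeatKernel t m| =
      ‖∫ k in (-π)..π, (Complex.exp (Complex.I * ((k : ℂ) + lam * Complex.I)) - 1) *
        srwHeatIntegrand t m ((k : ℂ) + lam * Complex.I)‖ := by
    rw [← fwdDiff_srwHeatKernel_eq_integral, Complex.norm_real, Real.norm_eq_abs, abs_mul,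
      abs_of_pos hπ]
  have hc0 : Continuous fun k : ℝ => Real.exp (-(t * (1 - Real.cos k))) := by fun_prop
  have hc1 : Continuous fun k : ℝ => |k| * Real.exp (-(t * (1 - Real.cos k))) := by fun_prop
  have h := norm_integral_mul_srwHeatIntegrand_shift_le ht m lam
    (M := fun k => Complex.exp (Complex.I * ((k : ℂ) + lam * Complex.I)) - 1)
    (B := fun k => |k| + 2 * |lam|) (by fun_prop) (by fun_prop)
    (fun k _ => norm_cexp_I_mul_shift_sub_one_le k hl)
  rw [hnorm]
  refine h.trans (mul_le_mul_of_nonneg_left ?_ (Real.exp_pos _).le)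
  have hsplit : ∫ k in (-π)..π, (|k| + 2 * |lam|) * Real.exp (-(t * (1 - Real.cos k))) =
      (∫ k in (-π)..π, |k| * Real.exp (-(t * (1 - Real.cos k)))) +
        2 * |lam| * ∫ k in (-π)..π, Real.exp (-(t * (1 - Real.cos k))) := by
    rw [← intervalIntegral.integral_const_mul, ← intervalIntegral.integral_add
      (hc1.intervalIntegrable _ _) ((hc0.const_mul _).intervalIntegrable _ _)]
    congr 1
    funext k
    ring
  rw [hsplit]
  gcongr
  · exact integral_abs_mul_exp_neg_mul_one_sub_cos_le ht
  · exact integral_exp_neg_mul_one_sub_cos_le ht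

/-- **Chernoff bound for the second difference**: for `t ≥ 0`, `m ∈ ℤ`, `|λ| ≤ 1`,
`2π |q_t(m+1) - 2q_t(m) + q_t(m-1)| ≤ e^{-λm + t(cosh λ - 1)} (256 (1∨t)^{-1}(1∨t)^{-1/2} + 8λ² · 2π (1∨t)^{-1/2})`.
[folklore] -/
theorem abs_sndDiff_srwHeatKernel_le_exp {t : ℝ} (ht : 0 ≤ t) (m : ℤ) {lam : ℝ} (hl : |lam| ≤ 1) :
    2 * π * |srwHeatKernel t (m + 1) - 2 * srwHeatKernel t m + srwHeatKernel t (m - 1)| ≤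
      Real.exp (-(lam * m) + t * (Real.cosh lam - 1)) *
        (256 * ((max 1 t)⁻¹ * (max 1 t) ^ (-(1 / 2 : ℝ))) +
          8 * lam ^ 2 * (2 * π * (max 1 t) ^ (-(1 / 2 : ℝ)))) := by
  have hπ : 0 < 2 * π := by positivity
  have hnorm : 2 * π * |srwHeatKernel t (m + 1) - 2 * srwHeatKernel t m + srwHeatKernel t (m - 1)| =
      ‖∫ k in (-π)..π, (Complex.exp (Complex.I * ((k : ℂ) + lam * Complex.I)) - 2 +
          Complex.exp (-(Complex.I * ((k : ℂ) + lam * Complex.I)))) *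
        srwHeatIntegrand t m ((k : ℂ) + lam * Complex.I)‖ := by
    rw [← sndDiff_srwHeatKernel_eq_integral, Complex.norm_real, Real.norm_eq_abs, abs_mul,
      abs_of_pos hπ]
  have hc0 : Continuous fun k : ℝ => Real.exp (-(t * (1 - Real.cos k))) := by fun_prop
  have hc2 : Continuous fun k : ℝ => k ^ 2 * Real.exp (-(t * (1 - Real.cos k))) := by fun_prop
  have hmult : ∀ k : ℝ, ‖Complex.exp (Complex.I * ((k : ℂ) + lam * Complex.I)) - 2 +
      Complex.exp (-(Complex.I * ((k : ℂ) + lam * Complex.I)))‖ ≤ 2 * k ^ 2 + 8 * lam ^ 2 := by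
    intro k
    have hfac : Complex.exp (Complex.I * ((k : ℂ) + lam * Complex.I)) - 2 +
        Complex.exp (-(Complex.I * ((k : ℂ) + lam * Complex.I))) =
        -((Complex.exp (Complex.I * ((k : ℂ) + lam * Complex.I)) - 1) *
          (Complex.exp (-(Complex.I * ((k : ℂ) + lam * Complex.I))) - 1)) := by
      have hee : Complex.exp (Complex.I * ((k : ℂ) + lam * Complex.I)) *
          Complex.exp (-(Complex.I * ((k : ℂ) + lam * Complex.I))) = 1 := by
        rw [← Complex.exp_add, add_neg_cancel, Complex.exp_zero]
      linear_combination hee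
    rw [hfac, norm_neg, norm_mul]
    calc ‖Complex.exp (Complex.I * ((k : ℂ) + lam * Complex.I)) - 1‖ *
          ‖Complex.exp (-(Complex.I * ((k : ℂ) + lam * Complex.I))) - 1‖
        ≤ (|k| + 2 * |lam|) * (|k| + 2 * |lam|) :=
          mul_le_mul (norm_cexp_I_mul_shift_sub_one_le k hl)
            (norm_cexp_neg_I_mul_shift_sub_one_le k hl) (norm_nonneg _) (by positivity)
      _ = (|k| + 2 * |lam|) ^ 2 := (sq _).symm
      _ ≤ 2 * k ^ 2 + 8 * lam ^ 2 := abs_add_two_mul_abs_sq_le k lam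
  have h := norm_integral_mul_srwHeatIntegrand_shift_le ht m lam
    (M := fun k => Complex.exp (Complex.I * ((k : ℂ) + lam * Complex.I)) - 2 +
          Complex.exp (-(Complex.I * ((k : ℂ) + lam * Complex.I))))
    (B := fun k => 2 * k ^ 2 + 8 * lam ^ 2) (by fun_prop) (by fun_prop) (fun k _ => hmult k)
  rw [hnorm]
  refine h.trans (mul_le_mul_of_nonneg_left ?_ (Real.exp_pos _).le)
  have hsplit : ∫ k in (-π)..π, (2 * k ^ 2 + 8 * lam ^ 2) * Real.exp (-(t * (1 - Real.cos k))) =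
      2 * (∫ k in (-π)..π, k ^ 2 * Real.exp (-(t * (1 - Real.cos k)))) +
        8 * lam ^ 2 * ∫ k in (-π)..π, Real.exp (-(t * (1 - Real.cos k))) := by
    rw [← intervalIntegral.integral_const_mul, ← intervalIntegral.integral_const_mul,
      ← intervalIntegral.integral_add ((hc2.const_mul _).intervalIntegrable _ _)
      ((hc0.const_mul _).intervalIntegrable _ _)]
    congr 1
    funext k
    ring
  rw [hsplit]
  have I0 := integral_exp_neg_mul_one_sub_cos_le ht
  have I2 := integral_sq_mul_exp_neg_mul_one_sub_cos_le ht
  calc 2 * (∫ k in (-π)..π, k ^ 2 * Real.exp (-(t * (1 - Real.cos k)))) +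
        8 * lam ^ 2 * ∫ k in (-π)..π, Real.exp (-(t * (1 - Real.cos k)))
      ≤ 2 * (128 * ((max 1 t)⁻¹ * (max 1 t) ^ (-(1 / 2 : ℝ)))) +
        8 * lam ^ 2 * (2 * π * (max 1 t) ^ (-(1 / 2 : ℝ))) := by gcongr
    _ = _ := by ring

/-! ### From exponential to polynomial (Gaussian) weights -/

/-- The Gaussian regime of the Chernoff exponent: for `0 < t`, `|m| ≤ t` and `λ = m/t`,
`-λm + t(cosh λ - 1) ≤ -m²/(8t)` (`cosh λ - 1 ≤ (7/8)λ²` on `[-1, 1]`). [folklore] -/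
theorem chernoff_exponent_gauss_le {t : ℝ} (ht : 0 < t) {m : ℝ} (hm : |m| ≤ t) :
    -(m / t * m) + t * (Real.cosh (m / t) - 1) ≤ -(m ^ 2 / (8 * t)) := by
  have hl : |m / t| ≤ 1 := by rw [abs_div, abs_of_pos ht, div_le_one ht]; exact hm
  have hc := cosh_sub_one_le hl
  have e2 : t * (7 / 8 * (m / t) ^ 2) = 7 / 8 * (m ^ 2 / t) := by field_simp
  have h1 : t * (Real.cosh (m / t) - 1) ≤ 7 / 8 * (m ^ 2 / t) := by
    rw [← e2]; exact mul_le_mul_of_nonneg_left hc ht.le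
  have e1 : m / t * m = m ^ 2 / t := by rw [div_mul_eq_mul_div, sq]
  have e3 : -(m ^ 2 / (8 * t)) = -(m ^ 2 / t) + 7 / 8 * (m ^ 2 / t) := by field_simp; ring
  rw [e1, e3]; linarith

/-- The Poisson regime of the Chernoff exponent: for `0 ≤ t ≤ |m|` and `λ = ±1`,
`-|m| + t(cosh 1 - 1) ≤ -|m|/8`. [folklore] -/
theorem chernoff_exponent_poisson_le {t m : ℝ} (ht : 0 ≤ t) (hm : t ≤ |m|) :
    -|m| + t * (Real.cosh 1 - 1) ≤ -(|m| / 8) := by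
  have hc := cosh_sub_one_le (show |(1 : ℝ)| ≤ 1 by norm_num)
  have : t * (Real.cosh 1 - 1) ≤ t * (7 / 8) := mul_le_mul_of_nonneg_left (by simpa using hc) ht
  linarith

/-- **From the Chernoff bound to Gaussian-weighted decay.** If a kernel `Φ_t(m)` satisfies, for all
`t > 0`, `m ∈ ℤ`, `|λ| ≤ 1`, the shifted-contour bound
`|Φ_t(m)| ≤ e^{-λm + t(cosh λ - 1)} (X s^{a+1} + Y |λ|^a s)` with `s = (1 ∨ t)^{-1/2}`, then for every
`p : ℕ` there is `A > 0` with `|Φ_t(m)| ≤ A s^{a+1} (1 + m²/(1 ∨ t))^{-p}`: take `λ = m/t` in the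
Gaussian regime `|m| ≤ t` (where `|λ|^a s ≤ s^{a+1}(1 + m²/(1∨t))^a`) and `λ = ±1` in the Poisson
regime `|m| > t`, and trade the exponential weights `e^{-m²/(8(1∨t))}`, `e^{-|m|/8}` for polynomial
ones. The case `a = 0`, `Y = 0` is `srwHeatKernel_decay`. [folklore] -/
theorem decay_of_chernoff_bound {Φ : ℝ → ℤ → ℝ} {X Y : ℝ} (hX : 0 ≤ X) (hY : 0 ≤ Y) (a p : ℕ)
    (h : ∀ t : ℝ, 0 < t → ∀ m : ℤ, ∀ lam : ℝ, |lam| ≤ 1 →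
      |Φ t m| ≤ Real.exp (-(lam * m) + t * (Real.cosh lam - 1)) *
        (X * ((max 1 t) ^ (-(1 / 2 : ℝ))) ^ (a + 1) + Y * |lam| ^ a * (max 1 t) ^ (-(1 / 2 : ℝ)))) :
    ∃ A : ℝ, 0 < A ∧ ∀ t : ℝ, 0 < t → ∀ m : ℤ,
      |Φ t m| ≤ A * ((max 1 t) ^ (-(1 / 2 : ℝ))) ^ (a + 1) * ((1 + (m : ℝ) ^ 2 / max 1 t) ^ p)⁻¹ := by
  set CA : ℝ := (X + Y) * (8 ^ (p + a) * (p + a).factorial * Real.exp (1 / 8)) with hCA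
  set CB : ℝ := (X + Y) * (2 ^ (p + a) * 8 ^ (2 * (p + a)) * (2 * (p + a)).factorial) with hCB
  have hCA0 : 0 ≤ CA := by positivity
  have hCB0 : 0 ≤ CB := by positivity
  refine ⟨max CA CB + 1, by positivity, fun t ht m => ?_⟩
  have h := h t ht m
  have hss : (max 1 t) ^ (-(1 / 2 : ℝ)) * (max 1 t) ^ (-(1 / 2 : ℝ)) = (max 1 t)⁻¹ :=
    max_one_rpow_neg_half_mul_self t
  set T : ℝ := max 1 t with hT
  set s : ℝ := T ^ (-(1 / 2 : ℝ)) with hs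
  have hT1 : 1 ≤ T := le_max_left _ _
  have hT0 : 0 < T := by positivity
  have htT : t ≤ T := le_max_right _ _
  have hs0 : 0 < s := Real.rpow_pos_of_pos hT0 _
  have hs1 : s ≤ 1 := Real.rpow_le_one_of_one_le_of_nonpos hT1 (by norm_num)
  have hsa1 : s ^ (a + 1) ≤ s := by
    rw [pow_succ]
    exact mul_le_of_le_one_left hs0.le (pow_le_one₀ hs0.le hs1)
  set u : ℝ := (m : ℝ) ^ 2 / T with hu
  have hu0 : 0 ≤ u := by positivity
  have hw : 0 < (1 + u) ^ p := by positivity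
  have hmax : max CA CB ≤ max CA CB + 1 := by linarith
  rw [← div_eq_mul_inv, le_div_iff₀ hw]
  rcases le_or_gt (|(m : ℝ)|) t with hmt | hmt
  · -- Gaussian regime, `λ = m/t`
    have hl : |(m : ℝ) / t| ≤ 1 := by rw [abs_div, abs_of_pos ht, div_le_one ht]; exact hmt
    have h1 := h ((m : ℝ) / t) hl
    have hexp : Real.exp (-((m : ℝ) / t * m) + t * (Real.cosh ((m : ℝ) / t) - 1)) ≤
        Real.exp (-(u / 8)) := by
      rw [Real.exp_le_exp]
      refine (chernoff_exponent_gauss_le ht hmt).trans ?_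
      rw [hu, neg_le_neg_iff, div_div]
      exact div_le_div_of_nonneg_left (by positivity) (by positivity) (by nlinarith)
    have hlam : |(m : ℝ) / t| ^ a * s ≤ s ^ (a + 1) * (1 + u) ^ a := by
      rcases le_or_gt 1 t with ht1 | ht1
      · have hTt : T = t := max_eq_right ht1
        have hst : s * s = t⁻¹ := by rw [hss, hTt]
        have key : |(m : ℝ) / t| ≤ s * (1 + u) := by
          rw [abs_div, abs_of_pos ht, hu, hTt]
          have hy : |(m : ℝ)| * s ≤ 1 + (|(m : ℝ)| * s) ^ 2 := by
            nlinarith [sq_nonneg (|(m : ℝ)| * s - 1)]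
          calc |(m : ℝ)| / t = (|(m : ℝ)| * s) * s := by rw [mul_assoc, hst, div_eq_mul_inv]
            _ ≤ (1 + (|(m : ℝ)| * s) ^ 2) * s := by gcongr
            _ = s * (1 + (m : ℝ) ^ 2 / t) := by rw [mul_pow, sq_abs, div_eq_mul_inv, ← hst]; ring
        calc |(m : ℝ) / t| ^ a * s ≤ (s * (1 + u)) ^ a * s := by gcongr
          _ = s ^ (a + 1) * (1 + u) ^ a := by rw [mul_pow]; ring
      · -- `t < 1` forces `m = 0`
        have hm0 : m = 0 := by
          have h2 : |(m : ℝ)| < 1 := lt_of_le_of_lt hmt ht1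
          rw [← Int.cast_abs] at h2
          have h3 : |m| < 1 := by exact_mod_cast h2
          exact Int.abs_lt_one_iff.1 h3
        have hT1' : T = 1 := max_eq_left ht1.le
        have hs1' : s = 1 := by rw [hs, hT1', Real.one_rpow]
        have hu1 : u = 0 := by rw [hu, hm0]; simp
        rw [hm0, hs1', hu1]
        simp only [Int.cast_zero, zero_div, abs_zero, mul_one, one_pow, add_zero]
        exact pow_le_one₀ le_rfl zero_le_one
    have hinner : X * s ^ (a + 1) + Y * |(m : ℝ) / t| ^ a * s ≤
        (X + Y) * s ^ (a + 1) * (1 + u) ^ a := by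
      have h1u : 1 ≤ (1 + u) ^ a := one_le_pow₀ (by linarith)
      have hsa : 0 ≤ s ^ (a + 1) := by positivity
      have h2 : Y * |(m : ℝ) / t| ^ a * s ≤ Y * (s ^ (a + 1) * (1 + u) ^ a) := by
        rw [mul_assoc]; exact mul_le_mul_of_nonneg_left hlam hY
      have h3 : X * s ^ (a + 1) ≤ X * s ^ (a + 1) * (1 + u) ^ a :=
        le_mul_of_one_le_right (mul_nonneg hX hsa) h1u
      calc X * s ^ (a + 1) + Y * |(m : ℝ) / t| ^ a * s
          ≤ X * s ^ (a + 1) * (1 + u) ^ a + Y * (s ^ (a + 1) * (1 + u) ^ a) := add_le_add h3 h2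
        _ = (X + Y) * s ^ (a + 1) * (1 + u) ^ a := by ring
    calc |Φ t m| * (1 + u) ^ p
        ≤ (Real.exp (-(u / 8)) * ((X + Y) * s ^ (a + 1) * (1 + u) ^ a)) * (1 + u) ^ p := by
          refine mul_le_mul_of_nonneg_right ?_ hw.le
          exact h1.trans (mul_le_mul hexp hinner (by positivity) (Real.exp_pos _).le)
      _ = (X + Y) * s ^ (a + 1) * ((1 + u) ^ (p + a) * Real.exp (-(u / 8))) := by
          rw [pow_add]; ring
      _ ≤ (X + Y) * s ^ (a + 1) * (8 ^ (p + a) * (p + a).factorial * Real.exp (1 / 8)) :=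
          mul_le_mul_of_nonneg_left (one_add_pow_mul_exp_neg_le (p + a) hu0) (by positivity)
      _ = CA * s ^ (a + 1) := by rw [hCA]; ring
      _ ≤ (max CA CB + 1) * s ^ (a + 1) := by gcongr; exact (le_max_left CA CB).trans hmax
  · -- Poisson regime, `λ = ±1`
    have hm1 : (1 : ℝ) ≤ |(m : ℝ)| := by
      have h2 : (0 : ℝ) < |(m : ℝ)| := ht.trans hmt
      rw [← Int.cast_abs] at h2 ⊢
      have h3 : (0 : ℤ) < |m| := by exact_mod_cast h2
      exact_mod_cast h3
    set lam : ℝ := if 0 ≤ m then 1 else -1 with hlam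
    have hl : |lam| ≤ 1 := by rw [hlam]; split_ifs <;> simp
    have hlm : -(lam * m) = -|(m : ℝ)| := by
      rw [hlam]
      split_ifs with h0
      · rw [abs_of_nonneg (by exact_mod_cast h0), one_mul]
      · rw [abs_of_neg (by exact_mod_cast (lt_of_not_ge h0)), neg_one_mul, neg_neg]
    have hcosh : Real.cosh lam = Real.cosh 1 := by rw [hlam]; split_ifs <;> simp [Real.cosh_neg]
    have hla : |lam| ^ a ≤ 1 := pow_le_one₀ (abs_nonneg _) hl
    have h1 := h lam hl
    rw [hlm, hcosh] at h1
    have hexp : Real.exp (-|(m : ℝ)| + t * (Real.cosh 1 - 1)) ≤ Real.exp (-(|(m : ℝ)| / 8)) :=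
      Real.exp_le_exp.2 (chernoff_exponent_poisson_le ht.le hmt.le)
    have hin : X * s ^ (a + 1) + Y * |lam| ^ a * s ≤ (X + Y) * s := by
      have h2 : Y * |lam| ^ a * s ≤ Y * 1 * s := by gcongr
      have h3 : X * s ^ (a + 1) ≤ X * s := mul_le_mul_of_nonneg_left hsa1 hX
      linarith
    have hsT : T⁻¹ ≤ s := by
      rw [hs, ← Real.rpow_neg_one]
      exact Real.rpow_le_rpow_of_exponent_le hT1 (by norm_num)
    have hTm : T ≤ 1 + (m : ℝ) ^ 2 := by
      have h2 : T ≤ |(m : ℝ)| := max_le hm1 hmt.le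
      nlinarith [sq_abs (m : ℝ)]
    have hkey : s ≤ s ^ (a + 1) * (1 + (m : ℝ) ^ 2) ^ a := by
      rw [pow_succ, mul_comm (s ^ a) s, mul_assoc, ← mul_pow]
      refine le_mul_of_one_le_right hs0.le (one_le_pow₀ ?_)
      calc (1 : ℝ) = T⁻¹ * T := by field_simp
        _ ≤ s * (1 + (m : ℝ) ^ 2) := mul_le_mul hsT hTm hT0.le hs0.le
    have hup : (1 + u) ^ p ≤ (1 + (m : ℝ) ^ 2) ^ p := by
      apply pow_le_pow_left₀ (by positivity)
      rw [hu]
      gcongr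
      exact div_le_self (by positivity) hT1
    calc |Φ t m| * (1 + u) ^ p
        ≤ (Real.exp (-(|(m : ℝ)| / 8)) * ((X + Y) * s)) * (1 + (m : ℝ) ^ 2) ^ p :=
          mul_le_mul (h1.trans (mul_le_mul hexp hin (by positivity) (Real.exp_pos _).le)) hup
            hw.le (by positivity)
      _ ≤ (Real.exp (-(|(m : ℝ)| / 8)) * ((X + Y) * (s ^ (a + 1) * (1 + (m : ℝ) ^ 2) ^ a))) *
            (1 + (m : ℝ) ^ 2) ^ p :=
          mul_le_mul_of_nonneg_right (mul_le_mul_of_nonneg_left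
            (mul_le_mul_of_nonneg_left hkey (by positivity)) (Real.exp_pos _).le) (by positivity)
      _ = (X + Y) * s ^ (a + 1) * ((1 + (m : ℝ) ^ 2) ^ (p + a) * Real.exp (-(|(m : ℝ)| / 8))) := by
          rw [pow_add]; ring
      _ ≤ (X + Y) * s ^ (a + 1) * (2 ^ (p + a) * 8 ^ (2 * (p + a)) * (2 * (p + a)).factorial) := by
          refine mul_le_mul_of_nonneg_left ?_ (by positivity)
          have h2 := one_add_sq_pow_mul_exp_neg_le (p + a) hm1
          rwa [sq_abs] at h2
      _ = CB * s ^ (a + 1) := by rw [hCB]; ring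
      _ ≤ (max CA CB + 1) * s ^ (a + 1) := by gcongr; exact (le_max_right CA CB).trans hmax

/-! ### Gaussian-weighted decay of the differences -/

/-- **Decay of the forward difference of the heat kernel**: for every `p : ℕ` there is `A > 0`
with `|q_t(m+1) - q_t(m)| ≤ A (1 ∨ t)^{-1} (1 + m²/(1 ∨ t))^{-p}` for all `t > 0`, `m ∈ ℤ` — one
factor `(1 ∨ t)^{-1/2}` beyond the size of the kernel (cf. Lawler–Limic 2010, §2.3 for the
analogous gradient estimates derived from the LCLT). [folklore] -/
theorem srwHeatKernel_fwdDiff_decay (p : ℕ) : ∃ A : ℝ, 0 < A ∧ ∀ t : ℝ, 0 < t → ∀ m : ℤ,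
    |srwHeatKernel t (m + 1) - srwHeatKernel t m| ≤
      A * (max 1 t)⁻¹ * ((1 + (m : ℝ) ^ 2 / max 1 t) ^ p)⁻¹ := by
  have h2π : (0 : ℝ) < 2 * π := by positivity
  obtain ⟨A, hA, h⟩ := decay_of_chernoff_bound
    (Φ := fun t m => 2 * π * (srwHeatKernel t (m + 1) - srwHeatKernel t m))
    (X := 68) (Y := 4 * π) (by norm_num) (by positivity) 1 p (fun t ht m lam hl => by
      have h1 := abs_fwdDiff_srwHeatKernel_le_exp ht.le m hl
      rw [abs_mul, abs_of_pos h2π]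
      convert h1 using 2
      rw [pow_two, max_one_rpow_neg_half_mul_self t]
      ring)
  refine ⟨A / (2 * π), by positivity, fun t ht m => ?_⟩
  have h1 := h t ht m
  rw [abs_mul, abs_of_pos h2π, pow_two, max_one_rpow_neg_half_mul_self t] at h1
  calc |srwHeatKernel t (m + 1) - srwHeatKernel t m|
      = (2 * π)⁻¹ * (2 * π * |srwHeatKernel t (m + 1) - srwHeatKernel t m|) := by field_simp
    _ ≤ (2 * π)⁻¹ * (A * (max 1 t)⁻¹ * ((1 + (m : ℝ) ^ 2 / max 1 t) ^ p)⁻¹) := by gcongr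
    _ = A / (2 * π) * (max 1 t)⁻¹ * ((1 + (m : ℝ) ^ 2 / max 1 t) ^ p)⁻¹ := by ring

/-- **Decay of the backward difference of the heat kernel**: for every `p : ℕ` there is `A > 0`
with `|q_t(m) - q_t(m-1)| ≤ A (1 ∨ t)^{-1} (1 + m²/(1 ∨ t))^{-p}` for all `t > 0`, `m ∈ ℤ` (from the
forward difference at `-m`, by evenness of `q_t`). [folklore] -/
theorem srwHeatKernel_bwdDiff_decay (p : ℕ) : ∃ A : ℝ, 0 < A ∧ ∀ t : ℝ, 0 < t → ∀ m : ℤ,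
    |srwHeatKernel t m - srwHeatKernel t (m - 1)| ≤
      A * (max 1 t)⁻¹ * ((1 + (m : ℝ) ^ 2 / max 1 t) ^ p)⁻¹ := by
  obtain ⟨A, hA, h⟩ := srwHeatKernel_fwdDiff_decay p
  refine ⟨A, hA, fun t ht m => ?_⟩
  have h1 := h t ht (-m)
  rw [show -m + 1 = -(m - 1) by ring, srwHeatKernel_neg, srwHeatKernel_neg, abs_sub_comm,
    Int.cast_neg, neg_sq] at h1
  exact h1

/-- **Decay of the second difference of the heat kernel**: for every `p : ℕ` there is `A > 0` with
`|q_t(m+1) - 2q_t(m) + q_t(m-1)| ≤ A (1 ∨ t)^{-1} (1 ∨ t)^{-1/2} (1 + m²/(1 ∨ t))^{-p}` for all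
`t > 0`, `m ∈ ℤ` — two factors `(1 ∨ t)^{-1/2}` beyond the size of the kernel (cf. Lawler–Limic 2010,
§2.3). [folklore] -/
theorem srwHeatKernel_sndDiff_decay (p : ℕ) : ∃ A : ℝ, 0 < A ∧ ∀ t : ℝ, 0 < t → ∀ m : ℤ,
    |srwHeatKernel t (m + 1) - 2 * srwHeatKernel t m + srwHeatKernel t (m - 1)| ≤
      A * ((max 1 t)⁻¹ * (max 1 t) ^ (-(1 / 2 : ℝ))) * ((1 + (m : ℝ) ^ 2 / max 1 t) ^ p)⁻¹ := by
  have h2π : (0 : ℝ) < 2 * π := by positivity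
  have hcube : ∀ t : ℝ, ((max 1 t) ^ (-(1 / 2 : ℝ))) ^ (2 + 1) =
      (max 1 t)⁻¹ * (max 1 t) ^ (-(1 / 2 : ℝ)) := fun t => by
    rw [pow_succ, pow_two, max_one_rpow_neg_half_mul_self t]
  obtain ⟨A, hA, h⟩ := decay_of_chernoff_bound
    (Φ := fun t m => 2 * π * (srwHeatKernel t (m + 1) - 2 * srwHeatKernel t m + srwHeatKernel t (m - 1)))
    (X := 256) (Y := 16 * π) (by norm_num) (by positivity) 2 p (fun t ht m lam hl => by
      have h1 := abs_sndDiff_srwHeatKernel_le_exp ht.le m hl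
      rw [abs_mul, abs_of_pos h2π]
      convert h1 using 2
      rw [hcube t, sq_abs]
      ring)
  refine ⟨A / (2 * π), by positivity, fun t ht m => ?_⟩
  have h1 := h t ht m
  rw [abs_mul, abs_of_pos h2π, hcube t] at h1
  calc |srwHeatKernel t (m + 1) - 2 * srwHeatKernel t m + srwHeatKernel t (m - 1)|
      = (2 * π)⁻¹ * (2 * π *
          |srwHeatKernel t (m + 1) - 2 * srwHeatKernel t m + srwHeatKernel t (m - 1)|) := by
        field_simp
    _ ≤ (2 * π)⁻¹ * (A * ((max 1 t)⁻¹ * (max 1 t) ^ (-(1 / 2 : ℝ))) *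
          ((1 + (m : ℝ) ^ 2 / max 1 t) ^ p)⁻¹) := by gcongr
    _ = A / (2 * π) * ((max 1 t)⁻¹ * (max 1 t) ^ (-(1 / 2 : ℝ))) *
          ((1 + (m : ℝ) ^ 2 / max 1 t) ^ p)⁻¹ := by ring

end Literature.Probability.LatticeModels
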